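import Mathlib
import Literature.Analysis.FluidPDE.SelfSimilarEulerProfile
import Summits.NavierStokesRegularity.NavierStokesRegularity.Theorems.EulerZoomLiouvillePowerGaugeEulerLiouvilleCondenserPolarFrame
import Summits.NavierStokesRegularity.NavierStokesRegularity.Theorems.EulerZoomLiouvillePowerGaugeEulerLiouvilleCondenserComplexChart

/-!
# (SR) SLICE REDUCTION — plate t50-SR of nsreg-p2 ROUND-47 «WHO HOLDS THE RIDGE»
(`r47/Sketch47.lean` sha16 f89f412bf4150db7 (v1.3; the Prop is byte-identical to v1.0 c5b0bf755040b563), text VERBATIM)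

Width piece for crux `EulerZoomLiouville.PowerGaugeEulerLiouville` (stmt-NavierStokesRegularity-19832), by name under
LEAD 19832 (ns-typeII-p2 g14) and planner nsreg-p2 g37 (exact infrastructure; the threshold use of the RMI is superseded by
§5/§5b, the identity chain Ib/I/SR stays as the slice instrument); seat ns-ezl-w2 g5,
`--supports stmt-NavierStokesRegularity-19832 --as helper`.

For a self-similar Euler profile (`IsSelfSimilarEulerProfile γ 0 V P`: `(1−γ)V + DV(y)[γy + V] + ∇P = 0`, `div V = 0`,
`V ∈ C²`, `P ∈ C¹`) and a point `y`, the 2-D data of the coordinate slice `{x₂ = y₂}` read in the chart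
`Φ_y z = y + z.re•e₀ + z.im•e₁` — `p = P∘Φ_y`, `v = (V₀,V₁)∘Φ_y` as a `ℂ`-valued field, `w = γy₂ + V₂∘Φ_y`,
`a = ((DVe₂)₀,(DVe₂)₁)∘Φ_y`, `b = (DVe₂)₂∘Φ_y` — satisfy the hypotheses of (I) `SliceRadialMomentumIdentity`:
`p, v ∈ C¹`, `a, w, b` continuous, `∇p = −(1−γ)v − Dv[γ(z+ζ₀) + v] − w·a` (`ζ₀ = (y₀,y₁)`) and `div v = −b`.
Proof: chain rule through the affine chart (`DΦ_y = ι`, `ι h = h.re•e₀ + h.im•e₁`, tree `Condenser.cchartLin_apply` of t47-X),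
`⟪X, ι h⟫_{ℝ³} = ⟪(X₀,X₁), h⟫_ℂ`, the
decomposition `γx + V x = ι(γ(z+ζ₀) + v z) + w z•e₂` at `x = Φ_y z`, and `div V = Σᵢ⟪eᵢ, DVeᵢ⟫`.

* `sliceReduction_of` (working form), `sliceReduction` = `NsregP2.R47.SliceReduction` binder-for-binder (`E3`, `cchart`
  written out).

HONEST FRAMING: chain-rule bookkeeping; proves nothing about the crux E (19832 OPEN), any door Target, or Navier–Stokes
regularity; no summit statement is touched. [folklore]
-/

noncomputable section

open Set Filter Topology Metric Function MeasureTheory Complex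
open scoped Real RealInnerProductSpace

set_option linter.dupNamespace false

namespace Summit.NavierStokesRegularity.NavierStokesRegularity.Theorems.PowerGaugeEulerLiouville.Condenser

open Literature.Analysis Literature.Analysis.FluidPDE

/-! ## §1 The chart, its differential, and the transverse projection -/

/-- The transverse projection `π X = (X₀, X₁) ∈ ℂ` as a continuous linear map `ℝ³ →L[ℝ] ℂ`. [folklore] -/
theorem sliceProjection_apply (X : EuclideanSpace ℝ (Fin 3)) :
    ((EuclideanSpace.proj (0 : Fin 3) : EuclideanSpace ℝ (Fin 3) →L[ℝ] ℝ).smulRight (1 : ℂ) +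
        (EuclideanSpace.proj (1 : Fin 3) : EuclideanSpace ℝ (Fin 3) →L[ℝ] ℝ).smulRight I) X =
      Complex.mk (X 0) (X 1) := by
  apply Complex.ext <;> simp [ContinuousLinearMap.smulRight_apply]

/-- **`⟪X, ι h⟫_{ℝ³} = ⟪(X₀,X₁), h⟫_ℂ`.** [folklore] -/
theorem inner_sliceEmbedding (X : EuclideanSpace ℝ (Fin 3)) (h : ℂ) :
    ⟪X, h.re • EuclideanSpace.basisFun (Fin 3) ℝ 0 + h.im • EuclideanSpace.basisFun (Fin 3) ℝ 1⟫ =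
      ⟪Complex.mk (X 0) (X 1), h⟫ := by
  rw [inner_add_right, real_inner_smul_right, real_inner_smul_right, EuclideanSpace.inner_basisFun_real,
    EuclideanSpace.inner_basisFun_real, real_inner_complex_eq]
  simp only
  ring

/-- **The similarity drift on the slice**: at `x = y + z.re•e₀ + z.im•e₁`,
`γx + V x = ι(γ(z + (y₀,y₁)) + (V x)_⊥) + (γy₂ + (V x)₂)•e₂` with `(V x)_⊥ = ((V x)₀, (V x)₁) ∈ ℂ`. [folklore] -/
theorem drift_decomposition (γ : ℝ) (y X : EuclideanSpace ℝ (Fin 3)) (z : ℂ) :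
    γ • (y + z.re • EuclideanSpace.basisFun (Fin 3) ℝ 0 + z.im • EuclideanSpace.basisFun (Fin 3) ℝ 1) + X =
      ((γ • (z + Complex.mk (y 0) (y 1)) + Complex.mk (X 0) (X 1)).re • EuclideanSpace.basisFun (Fin 3) ℝ 0 +
        (γ • (z + Complex.mk (y 0) (y 1)) + Complex.mk (X 0) (X 1)).im • EuclideanSpace.basisFun (Fin 3) ℝ 1) +
      (γ * y 2 + X 2) • EuclideanSpace.basisFun (Fin 3) ℝ 2 := by
  ext j
  fin_cases j <;>
    simp [EuclideanSpace.basisFun_apply, Complex.add_re, Complex.add_im] <;> ring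

/-! ## §2 Slice reduction -/

/-- **(SR) SLICE REDUCTION**, working form.  See the module docstring. [folklore] -/
theorem sliceReduction_of {γ : ℝ} {V : EuclideanSpace ℝ (Fin 3) → EuclideanSpace ℝ (Fin 3)}
    {P : EuclideanSpace ℝ (Fin 3) → ℝ} (hprof : IsSelfSimilarEulerProfile γ 0 V P) (y : EuclideanSpace ℝ (Fin 3))
    {p : ℂ → ℝ} {v a : ℂ → ℂ} {w b : ℂ → ℝ}
    (hp : ∀ z : ℂ, p z = P (y + z.re • EuclideanSpace.basisFun (Fin 3) ℝ 0 + z.im • EuclideanSpace.basisFun (Fin 3) ℝ 1))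
    (hv : ∀ z : ℂ, v z =
      Complex.mk (V (y + z.re • EuclideanSpace.basisFun (Fin 3) ℝ 0 + z.im • EuclideanSpace.basisFun (Fin 3) ℝ 1) 0)
        (V (y + z.re • EuclideanSpace.basisFun (Fin 3) ℝ 0 + z.im • EuclideanSpace.basisFun (Fin 3) ℝ 1) 1))
    (hw : ∀ z : ℂ, w z =
      γ * y 2 + V (y + z.re • EuclideanSpace.basisFun (Fin 3) ℝ 0 + z.im • EuclideanSpace.basisFun (Fin 3) ℝ 1) 2)
    (ha : ∀ z : ℂ, a z =
      Complex.mk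
        (fderiv ℝ V (y + z.re • EuclideanSpace.basisFun (Fin 3) ℝ 0 + z.im • EuclideanSpace.basisFun (Fin 3) ℝ 1)
          (EuclideanSpace.basisFun (Fin 3) ℝ 2) 0)
        (fderiv ℝ V (y + z.re • EuclideanSpace.basisFun (Fin 3) ℝ 0 + z.im • EuclideanSpace.basisFun (Fin 3) ℝ 1)
          (EuclideanSpace.basisFun (Fin 3) ℝ 2) 1))
    (hb : ∀ z : ℂ, b z =
      fderiv ℝ V (y + z.re • EuclideanSpace.basisFun (Fin 3) ℝ 0 + z.im • EuclideanSpace.basisFun (Fin 3) ℝ 1)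
        (EuclideanSpace.basisFun (Fin 3) ℝ 2) 2) :
    ContDiff ℝ 1 p ∧ ContDiff ℝ 1 v ∧ Continuous a ∧ Continuous w ∧ Continuous b ∧
      (∀ z h : ℂ, fderiv ℝ p z h =
        ⟪-((1 - γ) • v z) - fderiv ℝ v z (γ • (z + Complex.mk (y 0) (y 1)) + v z) - w z • a z, h⟫) ∧
      (∀ z : ℂ, (fderiv ℝ v z 1).re + (fderiv ℝ v z Complex.I).im = - b z) := by
  -- notation: the frame, the chart differential `emb`, the transverse projection `prj`
  set e0 : EuclideanSpace ℝ (Fin 3) := EuclideanSpace.basisFun (Fin 3) ℝ 0 with he0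
  set e1 : EuclideanSpace ℝ (Fin 3) := EuclideanSpace.basisFun (Fin 3) ℝ 1 with he1
  set e2 : EuclideanSpace ℝ (Fin 3) := EuclideanSpace.basisFun (Fin 3) ℝ 2 with he2
  set emb : ℂ →L[ℝ] EuclideanSpace ℝ (Fin 3) := Complex.reCLM.smulRight e0 + Complex.imCLM.smulRight e1 with hemb
  set prj : EuclideanSpace ℝ (Fin 3) →L[ℝ] ℂ :=
    (EuclideanSpace.proj (0 : Fin 3) : EuclideanSpace ℝ (Fin 3) →L[ℝ] ℝ).smulRight (1 : ℂ) +
      (EuclideanSpace.proj (1 : Fin 3) : EuclideanSpace ℝ (Fin 3) →L[ℝ] ℝ).smulRight I with hprj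
  have hembz : ∀ z : ℂ, emb z = z.re • e0 + z.im • e1 := fun z => by rw [hemb, he0, he1]; exact cchartLin_apply z
  have hprjX : ∀ X : EuclideanSpace ℝ (Fin 3), prj X = Complex.mk (X 0) (X 1) := fun X => by
    rw [hprj]; exact sliceProjection_apply X
  have hΦ : ∀ z : ℂ, y + z.re • e0 + z.im • e1 = y + emb z := fun z => by rw [hembz, add_assoc]
  -- regularity of the profile
  have hV2 : ContDiff ℝ 2 V := hprof.contDiff_velocity
  have hV1 : ContDiff ℝ 1 V := hV2.of_le (by norm_num)
  have hVd : Differentiable ℝ V := hV1.differentiable one_ne_zero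
  have hP1 : ContDiff ℝ 1 P := hprof.contDiff_pressure
  have hPd : Differentiable ℝ P := hP1.differentiable one_ne_zero
  have hDVc : Continuous (fderiv ℝ V) := hV1.continuous_fderiv one_ne_zero
  have hΦc : ContDiff ℝ 1 fun z : ℂ => y + emb z := contDiff_const.add emb.contDiff
  have hΦd : ∀ z : ℂ, HasFDerivAt (fun z : ℂ => y + emb z) emb z := fun z => (emb.hasFDerivAt).const_add y
  -- the data as compositions
  have hpfun : p = fun z => P (y + emb z) := funext fun z => by rw [hp z, hΦ]
  have hvfun : v = fun z => prj (V (y + emb z)) := funext fun z => by rw [hv z, hprjX, hΦ]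
  have hwfun : w = fun z => γ * y 2 + (EuclideanSpace.proj (2 : Fin 3) : EuclideanSpace ℝ (Fin 3) →L[ℝ] ℝ)
      (V (y + emb z)) := funext fun z => by rw [hw z, hΦ]; rfl
  have hafun : a = fun z => prj (fderiv ℝ V (y + emb z) e2) := funext fun z => by rw [ha z, hprjX, hΦ]
  have hbfun : b = fun z => (EuclideanSpace.proj (2 : Fin 3) : EuclideanSpace ℝ (Fin 3) →L[ℝ] ℝ)
      (fderiv ℝ V (y + emb z) e2) := funext fun z => by rw [hb z, hΦ]; rfl
  -- (1)–(5): regularity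
  have hp1 : ContDiff ℝ 1 p := by rw [hpfun]; exact hP1.comp hΦc
  have hv1 : ContDiff ℝ 1 v := by rw [hvfun]; exact prj.contDiff.comp (hV1.comp hΦc)
  have hDc : Continuous fun z : ℂ => fderiv ℝ V (y + emb z) e2 := (hDVc.comp hΦc.continuous).clm_apply continuous_const
  have hac : Continuous a := by rw [hafun]; exact prj.continuous.comp hDc
  have hwc : Continuous w := by
    rw [hwfun]
    exact continuous_const.add ((EuclideanSpace.proj (2 : Fin 3)).continuous.comp (hV1.continuous.comp hΦc.continuous))
  have hbc : Continuous b := by rw [hbfun]; exact (EuclideanSpace.proj (2 : Fin 3)).continuous.comp hDc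
  -- derivatives of `p` and `v` through the chart
  have hpD : ∀ z h : ℂ, fderiv ℝ p z h = fderiv ℝ P (y + emb z) (emb h) := by
    intro z h
    have hd : HasFDerivAt p ((fderiv ℝ P (y + emb z)).comp emb) z := by
      rw [hpfun]; exact (hPd _).hasFDerivAt.comp z (hΦd z)
    rw [hd.fderiv, ContinuousLinearMap.comp_apply]
  have hvD : ∀ z u : ℂ, fderiv ℝ v z u = prj (fderiv ℝ V (y + emb z) (emb u)) := by
    intro z u
    have hd : HasFDerivAt v (prj.comp ((fderiv ℝ V (y + emb z)).comp emb)) z := by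
      rw [hvfun]; exact prj.hasFDerivAt.comp z ((hVd _).hasFDerivAt.comp z (hΦd z))
    rw [hd.fderiv, ContinuousLinearMap.comp_apply, ContinuousLinearMap.comp_apply]
  refine ⟨hp1, hv1, hac, hwc, hbc, fun z h => ?_, fun z => ?_⟩
  · -- (6) the slice momentum equation at `x = y + emb z`
    have hgrad : gradient P (y + emb z) =
        -((1 - γ) • V (y + emb z)) - fderiv ℝ V (y + emb z) (γ • (y + emb z) + V (y + emb z)) := by
      have h0 := hprof.profile_eq (y + emb z)
      rw [sub_zero] at h0
      rw [eq_sub_iff_add_eq, eq_neg_iff_add_eq_zero, ← h0]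
      abel
    have hdrift : γ • (y + emb z) + V (y + emb z) = emb (γ • (z + Complex.mk (y 0) (y 1)) + v z) + w z • e2 := by
      rw [← hΦ, hembz (γ • (z + Complex.mk (y 0) (y 1)) + v z), hv z, hw z, he0, he1, he2]
      exact drift_decomposition γ y (V (y + z.re • EuclideanSpace.basisFun (Fin 3) ℝ 0 +
        z.im • EuclideanSpace.basisFun (Fin 3) ℝ 1)) z
    have hvz : prj (V (y + emb z)) = v z := by rw [hvfun]
    have haz : prj (fderiv ℝ V (y + emb z) e2) = a z := by rw [hafun]
    rw [hpD, ← inner_gradient_left, hgrad, hdrift, map_add, map_smul, hembz h, he0, he1, inner_sliceEmbedding,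
      ← hprjX]
    simp only [map_sub, map_neg, map_add, map_smul]
    rw [hvz, haz]
    simp only [← hvD]
    congr 1; abel
  · -- (7) the divergence at `x = y + emb z`
    have hdiv := hprof.divFree (y + emb z)
    rw [divergence_eq_sum_inner_fderiv (EuclideanSpace.basisFun (Fin 3) ℝ) V (y + emb z), Fin.sum_univ_three,
      EuclideanSpace.basisFun_inner, EuclideanSpace.basisFun_inner, EuclideanSpace.basisFun_inner,
      ← he0, ← he1, ← he2] at hdiv
    have h1 : emb 1 = e0 := by rw [hembz]; simp
    have hI : emb I = e1 := by rw [hembz]; simp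
    rw [hvD, hvD, h1, hI, hprjX, hprjX, hb z, hΦ]
    simp only
    linarith

/-- **(SR) `NsregP2.R47.SliceReduction`, binder-for-binder** (Sketch47 of nsreg-p2 g37, plate t50-SR; `E3` and `cchart`
written out).  For a general unit vector `e` rotate first (t47-B′/t48-B″). [folklore] -/
theorem sliceReduction :
    ∀ (γ : ℝ) (V : EuclideanSpace ℝ (Fin 3) → EuclideanSpace ℝ (Fin 3)) (P : EuclideanSpace ℝ (Fin 3) → ℝ),
      IsSelfSimilarEulerProfile γ 0 V P → ∀ (y : EuclideanSpace ℝ (Fin 3)),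
      ∀ (p : ℂ → ℝ) (v a : ℂ → ℂ) (w b : ℂ → ℝ),
        (∀ z : ℂ, p z = P (y + z.re • EuclideanSpace.basisFun (Fin 3) ℝ 0 + z.im • EuclideanSpace.basisFun (Fin 3) ℝ 1)) →
        (∀ z : ℂ, v z = Complex.mk
          (V (y + z.re • EuclideanSpace.basisFun (Fin 3) ℝ 0 + z.im • EuclideanSpace.basisFun (Fin 3) ℝ 1) 0)
          (V (y + z.re • EuclideanSpace.basisFun (Fin 3) ℝ 0 + z.im • EuclideanSpace.basisFun (Fin 3) ℝ 1) 1)) →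
        (∀ z : ℂ, w z =
          γ * y 2 + V (y + z.re • EuclideanSpace.basisFun (Fin 3) ℝ 0 + z.im • EuclideanSpace.basisFun (Fin 3) ℝ 1) 2) →
        (∀ z : ℂ, a z = Complex.mk
          (fderiv ℝ V (y + z.re • EuclideanSpace.basisFun (Fin 3) ℝ 0 + z.im • EuclideanSpace.basisFun (Fin 3) ℝ 1)
            (EuclideanSpace.basisFun (Fin 3) ℝ 2) 0)
          (fderiv ℝ V (y + z.re • EuclideanSpace.basisFun (Fin 3) ℝ 0 + z.im • EuclideanSpace.basisFun (Fin 3) ℝ 1)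
            (EuclideanSpace.basisFun (Fin 3) ℝ 2) 1)) →
        (∀ z : ℂ, b z =
          fderiv ℝ V (y + z.re • EuclideanSpace.basisFun (Fin 3) ℝ 0 + z.im • EuclideanSpace.basisFun (Fin 3) ℝ 1)
            (EuclideanSpace.basisFun (Fin 3) ℝ 2) 2) →
        ContDiff ℝ 1 p ∧ ContDiff ℝ 1 v ∧ Continuous a ∧ Continuous w ∧ Continuous b ∧
          (∀ z h : ℂ, fderiv ℝ p z h =
            ⟪-((1 - γ) • v z) - fderiv ℝ v z (γ • (z + Complex.mk (y 0) (y 1)) + v z) - w z • a z, h⟫) ∧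
          (∀ z : ℂ, (fderiv ℝ v z 1).re + (fderiv ℝ v z Complex.I).im = - b z) :=
  fun _ _ _ hprof y _ _ _ _ _ hp hv hw ha hb => sliceReduction_of hprof y hp hv hw ha hb

end Summit.NavierStokesRegularity.NavierStokesRegularity.Theorems.PowerGaugeEulerLiouville.Condenser

end
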